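import Mathlib
import HarnessLib
import Summits.HubbardSuperconductivity.HubbardSuperconductivity.Theorems.KLProgrammeKLRegimeEngineTwoLegCutLegStepSplit
import Summits.HubbardSuperconductivity.HubbardSuperconductivity.Theorems.KLProgrammeKLRegimeTwoVolumeDualReadoutCut
import Summits.HubbardSuperconductivity.HubbardSuperconductivity.Theorems.KLProgrammeKLRegimeEngineTwoLegStepV17F2ClosersDual
import Summits.HubbardSuperconductivity.HubbardSuperconductivity.Theorems.KLProgrammeKLRegimeTwoVolumeGeometricRates

/-!
# Row C1 (`hcut`, the CUTOFF nested leg) of stubs (e)/(M) of `KLRegimeEngineV17F2` (stmt-HubbardSuperconductivity-20437) at every scale FROM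
# DUAL-LATTICE DATA: the composed read-out interface — twin of `…EngineTwoLegSpLegDualData` (cell gate-hubbard-kl, seat hubbard-kl-k3c5-p2 g7)

Composition of r2d-p1's cutoff-leg split door on private rates (`cutLeg_allScales_of_pointDefects_V17F2_rates`, …EngineTwoLegCutLegStepSplit) with the
two-cutoff dual read-out (`abs_symInterp_locRe_sub_le_frame_add_dualCutDefect`, …TwoVolumeDualReadoutCut).  Under STEP(n)'s binders (one torus `L₁`,
cutoffs `M₁ ≤ M₂`, both histories below `n`, the private rates, the frame comparability) the supplier owes per scale:

* (R) `hgrad n` (gradient of the first cutoff's reading on the frame-distance tube) — or, in `…_dualMoments_…`, r2d-p1's dual off-diagonal first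
  moment `hMs` of `𝒱_{L₁,M₁}⁽ⁿ⁾[K₁] − 𝒩_{K₁}` (GLOBAL gradient `2·Ms n + 4/3·Gfr₁U²`, no tube condition);
* (DUALCUT) `hdual n` — at SOME pins `(o₁, o₂)`, for each spin and each of the two string pairs (`ω₀^{(M₁)} ↔ ω₀^{(M₂)}`, reverses): the `ε`-weighted
  row difference `Σ_y (‖ε₁R₁(o₁;y) − ε₂R₂(o₂;y)‖ + ‖ε₁R₁(o₁;−y) − ε₂R₂(o₂;−y)‖) ≤ Dc n / L₁` (no lift, no far tails: one torus);
* the budget `b n·F_n/klCurveD + (F_n + Dc n) ≤ a n`, or — `cutLeg_allScales_of_dualMoments_V17F2_geometric4` — on the maximal geometric rates `d·4^n`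
  just `2·Ms n + 4/3·Gfr₁U² ≤ klCurveD` and `Dc n ≤ d·4^n/3` (`0 ≤ d ≤ Q.CL β 0/4`, `Q.CL β 0·4^n ≤ Q.CL β n`).

Proofs only (compositions); no definitions; nothing about the model is asserted; nothing asserts superconductivity.
References: BGM 2006 §2.1 (2.4)–(2.5), §2.4 (2.23), Lemma 2.1 (2.40) [cite: BenfattoGiulianiMastropietro2006].
-/

noncomputable section

namespace Summit.HubbardSuperconductivity.HubbardSuperconductivity.Theorems.EngineV8

set_option linter.dupNamespace false -- summit = problem name (single-conjunct summit), D-0017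

open Real Finset Complex Literature.MathematicalPhysics.QuantumLattice Literature.Probability.LatticeModels GrassmannAlgebra
open Summit.HubbardSuperconductivity.HubbardSuperconductivity.Theorems.KLProgrammeLegKernels
open Summit.HubbardSuperconductivity.HubbardSuperconductivity.Theorems.DispersionFlow
open Summit.HubbardSuperconductivity.HubbardSuperconductivity.Theorems.PerturbedFermiCurve
open Summit.HubbardSuperconductivity.HubbardSuperconductivity.Theorems.KLRegimeSplit
open Summit.HubbardSuperconductivity.HubbardSuperconductivity.Theorems.TwoPointAssembly
open Summit.HubbardSuperconductivity.HubbardSuperconductivity.Theorems.TwoVolumeDefect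
open Summit.HubbardSuperconductivity.HubbardSuperconductivity.Theorems.TwoLegFourier

section V17F2

variable {L : ℕ} {G : GeoConsts} {P : SplitConsts} {Q : EngConsts} {R : RenConsts} {β U μ c : ℝ}

/-- **ROW C1 (`hcut`) AT EVERY SCALE `n ≤ N ≤ nScales β + 1` FROM THE READING GRADIENT AND THE TWO-CUTOFF DUAL ROW DIFFERENCE, private rates**
(KL regime, `0 ≤ Gfr`, bare frame admissible `h0`, `klEngL₃ β U ≤ L`): (R) `hgrad`, (DUALCUT) `hdual`, budget `b n·F_n/klCurveD + (F_n + Dc n) ≤ a n`,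
`a n ≤ Q.CL β n/4` ⟹ the literal `hcut` of the (e)/(M) closers (history `histV17F2 ∧ TwoLegSlopes` at `(G, P, Q, R)`). -/
theorem cutLeg_allScales_of_dualData_V17F2_rates (hR : ∀ j, 0 ≤ R.Gfr j) (hc : 0 < c) (hcle : c ≤ klCurveC3 R) (hU : 0 < U)
    (hUle : U ≤ klCurveU0 R) (hβmin : klBetaMin ≤ β) (hβc : β ≤ Real.exp (c / U ^ 2)) (hμ : μ ∈ klWindowC) (hL : klEngL₃ β U ≤ L)
    (h0 : FrameOK R U (nScales β) μ 0) {N : ℕ} (hN : N ≤ nScales β + 1) {a b Dc : ℕ → ℝ} (ha : ∀ n ≤ N, a n ≤ Q.CL β n / 4)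
    (hb : ∀ n ≤ N, 0 ≤ b n)
    (hgrad : ∀ n ≤ N, ∀ (Mq : ℕ → ℕ) (L₁ M₁ M₂ : ℕ) [NeZero L₁] [NeZero M₁] [NeZero M₂], L ≤ L₁ → Q.M0 β L₁ ≤ M₁ → Mq L₁ ≤ M₁ →
      M₁ ≤ M₂ →
      (∀ j < n, histV17F2 L₁ M₁ G P Q R β U μ j ∧ TwoLegSlopes L₁ M₁ R β U μ (klFlowFrameU L₁ M₁ β U μ j) j) →
      (∀ j < n, histV17F2 L₁ M₂ G P Q R β U μ j ∧ TwoLegSlopes L₁ M₂ R β U μ (klFlowFrameU L₁ M₂ β U μ j) j) →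
      (∀ m < n, ∀ θ : ℝ, |klLocalPart L₁ M₁ β U μ (klFlowFrameU L₁ M₁ β U μ m) m θ -
        klLocalPart L₁ M₂ β U μ (klFlowFrameU L₁ M₂ β U μ m) m θ| ≤ a m / L₁) →
      (∀ q : Fin 2 → ℝ, |(klFlowFrameU L₁ M₁ β U μ n).eval q - (klFlowFrameU L₁ M₂ β U μ n).eval q| ≤ (∑ m ∈ range n, a m) / L₁) →
        ∀ q : Momentum, |frameLevel μ (klFlowFrameU L₁ M₁ β U μ n) q| ≤ (∑ m ∈ range n, a m) / L₁ →
          ‖fderiv ℝ (evalM (symInterp L₁ (klLocSelfEnergyRe L₁ M₁ β U μ (klFlowFrameU L₁ M₁ β U μ n) n))) q‖ ≤ b n)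
    (hdual : ∀ n ≤ N, ∀ (Mq : ℕ → ℕ) (L₁ M₁ M₂ : ℕ) [NeZero L₁] [NeZero M₁] [NeZero M₂], L ≤ L₁ → Q.M0 β L₁ ≤ M₁ → Mq L₁ ≤ M₁ →
      M₁ ≤ M₂ →
      (∀ j < n, histV17F2 L₁ M₁ G P Q R β U μ j ∧ TwoLegSlopes L₁ M₁ R β U μ (klFlowFrameU L₁ M₁ β U μ j) j) →
      (∀ j < n, histV17F2 L₁ M₂ G P Q R β U μ j ∧ TwoLegSlopes L₁ M₂ R β U μ (klFlowFrameU L₁ M₂ β U μ j) j) →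
      (∀ m < n, ∀ θ : ℝ, |klLocalPart L₁ M₁ β U μ (klFlowFrameU L₁ M₁ β U μ m) m θ -
        klLocalPart L₁ M₂ β U μ (klFlowFrameU L₁ M₂ β U μ m) m θ| ≤ a m / L₁) →
      (∀ q : Fin 2 → ℝ, |(klFlowFrameU L₁ M₁ β U μ n).eval q - (klFlowFrameU L₁ M₂ β U μ n).eval q| ≤ (∑ m ∈ range n, a m) / L₁) →
      ∃ (o₁ : SpaceTimeIdx L₁ M₁) (o₂ : SpaceTimeIdx L₁ M₂),
        (∀ σ : Fin 2, ∑ y : TorusSite 2 L₁,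
          (‖(imagTimeWeight β M₁ : ℂ) * (∑ t₁ : ImagTimeIdx M₁,
              sectorisedKernel L₁ M₁ β (trivialMultiplier L₁ M₁)
                  (klEffectiveAction L₁ M₁ β U μ (klFlowFrameU L₁ M₁ β U μ n) klE0 n - counterQuadratic L₁ M₁ β (klFlowFrameU L₁ M₁ β U μ n)) 2
                  (![((0, σ), 0), ((0, σ), 1)] : Fin 2 → SectorLeg 1) ![o₁, (t₁, o₁.2 + y)] *
                Complex.exp (((matsubaraFreq β M₁ (omega0 M₁) * (imagTime β M₁ o₁.1 - imagTime β M₁ t₁) : ℝ) : ℂ) * I)) -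
            (imagTimeWeight β M₂ : ℂ) * (∑ t₁ : ImagTimeIdx M₂,
              sectorisedKernel L₁ M₂ β (trivialMultiplier L₁ M₂)
                  (klEffectiveAction L₁ M₂ β U μ (klFlowFrameU L₁ M₂ β U μ n) klE0 n - counterQuadratic L₁ M₂ β (klFlowFrameU L₁ M₂ β U μ n)) 2
                  (![((0, σ), 0), ((0, σ), 1)] : Fin 2 → SectorLeg 1) ![o₂, (t₁, o₂.2 + y)] *
                Complex.exp (((matsubaraFreq β M₂ (omega0 M₂) * (imagTime β M₂ o₂.1 - imagTime β M₂ t₁) : ℝ) : ℂ) * I))‖ +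
          ‖(imagTimeWeight β M₁ : ℂ) * (∑ t₁ : ImagTimeIdx M₁,
              sectorisedKernel L₁ M₁ β (trivialMultiplier L₁ M₁)
                  (klEffectiveAction L₁ M₁ β U μ (klFlowFrameU L₁ M₁ β U μ n) klE0 n - counterQuadratic L₁ M₁ β (klFlowFrameU L₁ M₁ β U μ n)) 2
                  (![((0, σ), 0), ((0, σ), 1)] : Fin 2 → SectorLeg 1) ![o₁, (t₁, o₁.2 + -y)] *
                Complex.exp (((matsubaraFreq β M₁ (omega0 M₁) * (imagTime β M₁ o₁.1 - imagTime β M₁ t₁) : ℝ) : ℂ) * I)) -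
            (imagTimeWeight β M₂ : ℂ) * (∑ t₁ : ImagTimeIdx M₂,
              sectorisedKernel L₁ M₂ β (trivialMultiplier L₁ M₂)
                  (klEffectiveAction L₁ M₂ β U μ (klFlowFrameU L₁ M₂ β U μ n) klE0 n - counterQuadratic L₁ M₂ β (klFlowFrameU L₁ M₂ β U μ n)) 2
                  (![((0, σ), 0), ((0, σ), 1)] : Fin 2 → SectorLeg 1) ![o₂, (t₁, o₂.2 + -y)] *
                Complex.exp (((matsubaraFreq β M₂ (omega0 M₂) * (imagTime β M₂ o₂.1 - imagTime β M₂ t₁) : ℝ) : ℂ) * I))‖) ≤ Dc n / L₁) ∧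
        (∀ σ : Fin 2, ∑ y : TorusSite 2 L₁,
          (‖(imagTimeWeight β M₁ : ℂ) * (∑ t₁ : ImagTimeIdx M₁,
              sectorisedKernel L₁ M₁ β (trivialMultiplier L₁ M₁)
                  (klEffectiveAction L₁ M₁ β U μ (klFlowFrameU L₁ M₁ β U μ n) klE0 n - counterQuadratic L₁ M₁ β (klFlowFrameU L₁ M₁ β U μ n)) 2
                  (![((0, σ), 0), ((0, σ), 1)] : Fin 2 → SectorLeg 1) ![o₁, (t₁, o₁.2 + y)] *
                Complex.exp (((matsubaraFreq β M₁ (omega0 M₁).rev * (imagTime β M₁ o₁.1 - imagTime β M₁ t₁) : ℝ) : ℂ) * I)) -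
            (imagTimeWeight β M₂ : ℂ) * (∑ t₁ : ImagTimeIdx M₂,
              sectorisedKernel L₁ M₂ β (trivialMultiplier L₁ M₂)
                  (klEffectiveAction L₁ M₂ β U μ (klFlowFrameU L₁ M₂ β U μ n) klE0 n - counterQuadratic L₁ M₂ β (klFlowFrameU L₁ M₂ β U μ n)) 2
                  (![((0, σ), 0), ((0, σ), 1)] : Fin 2 → SectorLeg 1) ![o₂, (t₁, o₂.2 + y)] *
                Complex.exp (((matsubaraFreq β M₂ (omega0 M₂).rev * (imagTime β M₂ o₂.1 - imagTime β M₂ t₁) : ℝ) : ℂ) * I))‖ +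
          ‖(imagTimeWeight β M₁ : ℂ) * (∑ t₁ : ImagTimeIdx M₁,
              sectorisedKernel L₁ M₁ β (trivialMultiplier L₁ M₁)
                  (klEffectiveAction L₁ M₁ β U μ (klFlowFrameU L₁ M₁ β U μ n) klE0 n - counterQuadratic L₁ M₁ β (klFlowFrameU L₁ M₁ β U μ n)) 2
                  (![((0, σ), 0), ((0, σ), 1)] : Fin 2 → SectorLeg 1) ![o₁, (t₁, o₁.2 + -y)] *
                Complex.exp (((matsubaraFreq β M₁ (omega0 M₁).rev * (imagTime β M₁ o₁.1 - imagTime β M₁ t₁) : ℝ) : ℂ) * I)) -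
            (imagTimeWeight β M₂ : ℂ) * (∑ t₁ : ImagTimeIdx M₂,
              sectorisedKernel L₁ M₂ β (trivialMultiplier L₁ M₂)
                  (klEffectiveAction L₁ M₂ β U μ (klFlowFrameU L₁ M₂ β U μ n) klE0 n - counterQuadratic L₁ M₂ β (klFlowFrameU L₁ M₂ β U μ n)) 2
                  (![((0, σ), 0), ((0, σ), 1)] : Fin 2 → SectorLeg 1) ![o₂, (t₁, o₂.2 + -y)] *
                Complex.exp (((matsubaraFreq β M₂ (omega0 M₂).rev * (imagTime β M₂ o₂.1 - imagTime β M₂ t₁) : ℝ) : ℂ) * I))‖) ≤ Dc n / L₁))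
    (hbudget : ∀ n ≤ N, b n * (∑ m ∈ range n, a m) / klCurveD + ((∑ m ∈ range n, a m) + Dc n) ≤ a n) :
    ∀ n ≤ N, ∀ (Mq : ℕ → ℕ) (L₁ M₁ M₂ : ℕ) [NeZero L₁] [NeZero M₁] [NeZero M₂], L ≤ L₁ → Q.M0 β L₁ ≤ M₁ → Mq L₁ ≤ M₁ → M₁ ≤ M₂ →
      (∀ j < n, histV17F2 L₁ M₁ G P Q R β U μ j ∧ TwoLegSlopes L₁ M₁ R β U μ (klFlowFrameU L₁ M₁ β U μ j) j) →
      (∀ j < n, histV17F2 L₁ M₂ G P Q R β U μ j ∧ TwoLegSlopes L₁ M₂ R β U μ (klFlowFrameU L₁ M₂ β U μ j) j) →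
        ∀ θ : ℝ, |klLocalPart L₁ M₁ β U μ (klFlowFrameU L₁ M₁ β U μ n) n θ -
          klLocalPart L₁ M₂ β U μ (klFlowFrameU L₁ M₂ β U μ n) n θ| ≤ Q.CL β n / 4 / L₁ := by
  have hβ0 : 0 < β := lt_of_lt_of_le (by norm_num [klBetaMin]) hβmin
  refine cutLeg_allScales_of_pointDefects_V17F2_rates (G := G) (P := P) (d := fun n => (∑ m ∈ range n, a m) + Dc n)
    hR hc hcle hU hUle hβmin hβc hμ h0 hN ha hb hgrad ?_ hbudget
  intro n hn Mq L₁ M₁ M₂ _ _ _ hLL₁ hM₁ hMq hM₁₂ hh₁ hh₂ hrates hframe θ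
  have hL₁0 : (0 : ℝ) < L₁ := by exact_mod_cast Nat.pos_of_ne_zero (NeZero.ne L₁)
  -- degree guards of the two flow frames
  have hK₁ := frameOK_klFlowFrameU_of_histV17F2 (L' := L₁) (M' := M₁) hR h0 (hn.trans hN) hh₁
  have hK₂ := frameOK_klFlowFrameU_of_histV17F2 (L' := L₁) (M' := M₂) hR h0 (hn.trans hN) hh₂
  have hdeg₁ : (klFlowFrameU L₁ M₁ β U μ n).degree ≤ L₁ / 2 :=
    (frameOKDeg_klFlowFrameU hK₁ (hn.trans hN)).degree_le_half rfl hβmin (hL.trans hLL₁)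
  have hdeg₂ : (klFlowFrameU L₁ M₂ β U μ n).degree ≤ L₁ / 2 :=
    (frameOKDeg_klFlowFrameU hK₂ (hn.trans hN)).degree_le_half rfl hβmin (hL.trans hLL₁)
  obtain ⟨o₁, o₂, hDp, hDm⟩ := hdual n hn Mq L₁ M₁ M₂ hLL₁ hM₁ hMq hM₁₂ hh₁ hh₂ hrates hframe
  have hD := abs_symInterp_locRe_sub_le_frame_add_dualCutDefect (M₁ := M₁) (M₂ := M₂) hβ0 U μ hdeg₁ hdeg₂ n o₁ o₂ hDp hDm
    (klFermiPoint μ (klFlowFrameU L₁ M₂ β U μ n) θ)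
  refine hD.trans ?_
  have hKq := hframe (klFermiPoint μ (klFlowFrameU L₁ M₂ β U μ n) θ)
  have hsum : (∑ m ∈ range n, a m) / L₁ + Dc n / L₁ = ((∑ m ∈ range n, a m) + Dc n) / L₁ := by
    field_simp
  linarith [hsum]

/-- **ROW C1 (`hcut`) AT EVERY SCALE FROM DUAL-LATTICE TWO-LEG DATA ONLY, private rates**: as `cutLeg_allScales_of_dualData_V17F2_rates`, with (R)
replaced by the off-diagonal first spatial moment `Ms n ≥ 0` of the dual kernel of the FIRST cutoff's separated data `𝒱_{L₁,M₁}⁽ⁿ⁾[K₁] − 𝒩_{K₁}`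
(r2d-p1's `hMs` shape; GLOBAL gradient `2·Ms n + 4/3·Gfr₁U²`); budget `(2·Ms n + 4/3·Gfr₁U²)·F_n/klCurveD + (F_n + Dc n) ≤ a n`. -/
theorem cutLeg_allScales_of_dualMoments_V17F2_rates (hR : ∀ j, 0 ≤ R.Gfr j) (hc : 0 < c) (hcle : c ≤ klCurveC3 R) (hU : 0 < U)
    (hUle : U ≤ klCurveU0 R) (hβmin : klBetaMin ≤ β) (hβc : β ≤ Real.exp (c / U ^ 2)) (hμ : μ ∈ klWindowC) (hL : klEngL₃ β U ≤ L)
    (h0 : FrameOK R U (nScales β) μ 0) {N : ℕ} (hN : N ≤ nScales β + 1) {a Ms Dc : ℕ → ℝ} (ha : ∀ n ≤ N, a n ≤ Q.CL β n / 4)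
    (hMs0 : ∀ n ≤ N, 0 ≤ Ms n)
    (hMs : ∀ n ≤ N, ∀ (Mq : ℕ → ℕ) (L₁ M₁ M₂ : ℕ) [NeZero L₁] [NeZero M₁] [NeZero M₂], L ≤ L₁ → Q.M0 β L₁ ≤ M₁ → Mq L₁ ≤ M₁ →
      M₁ ≤ M₂ →
      (∀ j < n, histV17F2 L₁ M₁ G P Q R β U μ j ∧ TwoLegSlopes L₁ M₁ R β U μ (klFlowFrameU L₁ M₁ β U μ j) j) →
      (∀ j < n, histV17F2 L₁ M₂ G P Q R β U μ j ∧ TwoLegSlopes L₁ M₂ R β U μ (klFlowFrameU L₁ M₂ β U μ j) j) →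
      (∀ m < n, ∀ θ : ℝ, |klLocalPart L₁ M₁ β U μ (klFlowFrameU L₁ M₁ β U μ m) m θ -
        klLocalPart L₁ M₂ β U μ (klFlowFrameU L₁ M₂ β U μ m) m θ| ≤ a m / L₁) →
      (∀ q : Fin 2 → ℝ, |(klFlowFrameU L₁ M₁ β U μ n).eval q - (klFlowFrameU L₁ M₂ β U μ n).eval q| ≤ (∑ m ∈ range n, a m) / L₁) →
        ∀ (σ : Fin 2) (x₀ : SpaceTimeIdx L₁ M₁), imagTimeWeight β M₁ *
          ∑ x ∈ (univ : Finset (Fin 2 → SpaceTimeIdx L₁ M₁)).filter (fun x => x 0 = x₀ ∧ (x 1).2 ≠ (x 0).2),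
            (1 + ((((x 1).2 - (x 0).2) 0).valMinAbs.natAbs : ℝ) + ((((x 1).2 - (x 0).2) 1).valMinAbs.natAbs : ℝ)) ^ 1 *
              ‖sectorisedKernel L₁ M₁ β (trivialMultiplier L₁ M₁)
                  (klEffectiveAction L₁ M₁ β U μ (klFlowFrameU L₁ M₁ β U μ n) klE0 n - counterQuadratic L₁ M₁ β (klFlowFrameU L₁ M₁ β U μ n)) 2
                  (![((0, σ), 0), ((0, σ), 1)] : Fin 2 → SectorLeg 1) x‖ ≤ Ms n)
    (hdual : ∀ n ≤ N, ∀ (Mq : ℕ → ℕ) (L₁ M₁ M₂ : ℕ) [NeZero L₁] [NeZero M₁] [NeZero M₂], L ≤ L₁ → Q.M0 β L₁ ≤ M₁ → Mq L₁ ≤ M₁ →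
      M₁ ≤ M₂ →
      (∀ j < n, histV17F2 L₁ M₁ G P Q R β U μ j ∧ TwoLegSlopes L₁ M₁ R β U μ (klFlowFrameU L₁ M₁ β U μ j) j) →
      (∀ j < n, histV17F2 L₁ M₂ G P Q R β U μ j ∧ TwoLegSlopes L₁ M₂ R β U μ (klFlowFrameU L₁ M₂ β U μ j) j) →
      (∀ m < n, ∀ θ : ℝ, |klLocalPart L₁ M₁ β U μ (klFlowFrameU L₁ M₁ β U μ m) m θ -
        klLocalPart L₁ M₂ β U μ (klFlowFrameU L₁ M₂ β U μ m) m θ| ≤ a m / L₁) →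
      (∀ q : Fin 2 → ℝ, |(klFlowFrameU L₁ M₁ β U μ n).eval q - (klFlowFrameU L₁ M₂ β U μ n).eval q| ≤ (∑ m ∈ range n, a m) / L₁) →
      ∃ (o₁ : SpaceTimeIdx L₁ M₁) (o₂ : SpaceTimeIdx L₁ M₂),
        (∀ σ : Fin 2, ∑ y : TorusSite 2 L₁,
          (‖(imagTimeWeight β M₁ : ℂ) * (∑ t₁ : ImagTimeIdx M₁,
              sectorisedKernel L₁ M₁ β (trivialMultiplier L₁ M₁)
                  (klEffectiveAction L₁ M₁ β U μ (klFlowFrameU L₁ M₁ β U μ n) klE0 n - counterQuadratic L₁ M₁ β (klFlowFrameU L₁ M₁ β U μ n)) 2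
                  (![((0, σ), 0), ((0, σ), 1)] : Fin 2 → SectorLeg 1) ![o₁, (t₁, o₁.2 + y)] *
                Complex.exp (((matsubaraFreq β M₁ (omega0 M₁) * (imagTime β M₁ o₁.1 - imagTime β M₁ t₁) : ℝ) : ℂ) * I)) -
            (imagTimeWeight β M₂ : ℂ) * (∑ t₁ : ImagTimeIdx M₂,
              sectorisedKernel L₁ M₂ β (trivialMultiplier L₁ M₂)
                  (klEffectiveAction L₁ M₂ β U μ (klFlowFrameU L₁ M₂ β U μ n) klE0 n - counterQuadratic L₁ M₂ β (klFlowFrameU L₁ M₂ β U μ n)) 2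
                  (![((0, σ), 0), ((0, σ), 1)] : Fin 2 → SectorLeg 1) ![o₂, (t₁, o₂.2 + y)] *
                Complex.exp (((matsubaraFreq β M₂ (omega0 M₂) * (imagTime β M₂ o₂.1 - imagTime β M₂ t₁) : ℝ) : ℂ) * I))‖ +
          ‖(imagTimeWeight β M₁ : ℂ) * (∑ t₁ : ImagTimeIdx M₁,
              sectorisedKernel L₁ M₁ β (trivialMultiplier L₁ M₁)
                  (klEffectiveAction L₁ M₁ β U μ (klFlowFrameU L₁ M₁ β U μ n) klE0 n - counterQuadratic L₁ M₁ β (klFlowFrameU L₁ M₁ β U μ n)) 2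
                  (![((0, σ), 0), ((0, σ), 1)] : Fin 2 → SectorLeg 1) ![o₁, (t₁, o₁.2 + -y)] *
                Complex.exp (((matsubaraFreq β M₁ (omega0 M₁) * (imagTime β M₁ o₁.1 - imagTime β M₁ t₁) : ℝ) : ℂ) * I)) -
            (imagTimeWeight β M₂ : ℂ) * (∑ t₁ : ImagTimeIdx M₂,
              sectorisedKernel L₁ M₂ β (trivialMultiplier L₁ M₂)
                  (klEffectiveAction L₁ M₂ β U μ (klFlowFrameU L₁ M₂ β U μ n) klE0 n - counterQuadratic L₁ M₂ β (klFlowFrameU L₁ M₂ β U μ n)) 2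
                  (![((0, σ), 0), ((0, σ), 1)] : Fin 2 → SectorLeg 1) ![o₂, (t₁, o₂.2 + -y)] *
                Complex.exp (((matsubaraFreq β M₂ (omega0 M₂) * (imagTime β M₂ o₂.1 - imagTime β M₂ t₁) : ℝ) : ℂ) * I))‖) ≤ Dc n / L₁) ∧
        (∀ σ : Fin 2, ∑ y : TorusSite 2 L₁,
          (‖(imagTimeWeight β M₁ : ℂ) * (∑ t₁ : ImagTimeIdx M₁,
              sectorisedKernel L₁ M₁ β (trivialMultiplier L₁ M₁)
                  (klEffectiveAction L₁ M₁ β U μ (klFlowFrameU L₁ M₁ β U μ n) klE0 n - counterQuadratic L₁ M₁ β (klFlowFrameU L₁ M₁ β U μ n)) 2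
                  (![((0, σ), 0), ((0, σ), 1)] : Fin 2 → SectorLeg 1) ![o₁, (t₁, o₁.2 + y)] *
                Complex.exp (((matsubaraFreq β M₁ (omega0 M₁).rev * (imagTime β M₁ o₁.1 - imagTime β M₁ t₁) : ℝ) : ℂ) * I)) -
            (imagTimeWeight β M₂ : ℂ) * (∑ t₁ : ImagTimeIdx M₂,
              sectorisedKernel L₁ M₂ β (trivialMultiplier L₁ M₂)
                  (klEffectiveAction L₁ M₂ β U μ (klFlowFrameU L₁ M₂ β U μ n) klE0 n - counterQuadratic L₁ M₂ β (klFlowFrameU L₁ M₂ β U μ n)) 2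
                  (![((0, σ), 0), ((0, σ), 1)] : Fin 2 → SectorLeg 1) ![o₂, (t₁, o₂.2 + y)] *
                Complex.exp (((matsubaraFreq β M₂ (omega0 M₂).rev * (imagTime β M₂ o₂.1 - imagTime β M₂ t₁) : ℝ) : ℂ) * I))‖ +
          ‖(imagTimeWeight β M₁ : ℂ) * (∑ t₁ : ImagTimeIdx M₁,
              sectorisedKernel L₁ M₁ β (trivialMultiplier L₁ M₁)
                  (klEffectiveAction L₁ M₁ β U μ (klFlowFrameU L₁ M₁ β U μ n) klE0 n - counterQuadratic L₁ M₁ β (klFlowFrameU L₁ M₁ β U μ n)) 2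
                  (![((0, σ), 0), ((0, σ), 1)] : Fin 2 → SectorLeg 1) ![o₁, (t₁, o₁.2 + -y)] *
                Complex.exp (((matsubaraFreq β M₁ (omega0 M₁).rev * (imagTime β M₁ o₁.1 - imagTime β M₁ t₁) : ℝ) : ℂ) * I)) -
            (imagTimeWeight β M₂ : ℂ) * (∑ t₁ : ImagTimeIdx M₂,
              sectorisedKernel L₁ M₂ β (trivialMultiplier L₁ M₂)
                  (klEffectiveAction L₁ M₂ β U μ (klFlowFrameU L₁ M₂ β U μ n) klE0 n - counterQuadratic L₁ M₂ β (klFlowFrameU L₁ M₂ β U μ n)) 2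
                  (![((0, σ), 0), ((0, σ), 1)] : Fin 2 → SectorLeg 1) ![o₂, (t₁, o₂.2 + -y)] *
                Complex.exp (((matsubaraFreq β M₂ (omega0 M₂).rev * (imagTime β M₂ o₂.1 - imagTime β M₂ t₁) : ℝ) : ℂ) * I))‖) ≤ Dc n / L₁))
    (hbudget : ∀ n ≤ N, (2 * Ms n + 4 / 3 * R.Gfr 1 * U ^ 2) * (∑ m ∈ range n, a m) / klCurveD + ((∑ m ∈ range n, a m) + Dc n) ≤ a n) :
    ∀ n ≤ N, ∀ (Mq : ℕ → ℕ) (L₁ M₁ M₂ : ℕ) [NeZero L₁] [NeZero M₁] [NeZero M₂], L ≤ L₁ → Q.M0 β L₁ ≤ M₁ → Mq L₁ ≤ M₁ → M₁ ≤ M₂ →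
      (∀ j < n, histV17F2 L₁ M₁ G P Q R β U μ j ∧ TwoLegSlopes L₁ M₁ R β U μ (klFlowFrameU L₁ M₁ β U μ j) j) →
      (∀ j < n, histV17F2 L₁ M₂ G P Q R β U μ j ∧ TwoLegSlopes L₁ M₂ R β U μ (klFlowFrameU L₁ M₂ β U μ j) j) →
        ∀ θ : ℝ, |klLocalPart L₁ M₁ β U μ (klFlowFrameU L₁ M₁ β U μ n) n θ -
          klLocalPart L₁ M₂ β U μ (klFlowFrameU L₁ M₂ β U μ n) n θ| ≤ Q.CL β n / 4 / L₁ := by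
  have hβ0 : 0 < β := lt_of_lt_of_le (by norm_num [klBetaMin]) hβmin
  have h13 : 0 ≤ 4 / 3 * R.Gfr 1 * U ^ 2 := by have := hR 1; positivity
  refine cutLeg_allScales_of_dualData_V17F2_rates (G := G) (P := P) (b := fun n => 2 * Ms n + 4 / 3 * R.Gfr 1 * U ^ 2)
    hR hc hcle hU hUle hβmin hβc hμ hL h0 hN ha (fun n hn => by have := hMs0 n hn; positivity) ?_ hdual hbudget
  intro n hn Mq L₁ M₁ M₂ _ _ _ hLL₁ hM₁ hMq hM₁₂ hh₁ hh₂ hrates hframe q _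
  have hK₁ := frameOK_klFlowFrameU_of_histV17F2 (L' := L₁) (M' := M₁) hR h0 (hn.trans hN) hh₁
  have hdeg₁ : (klFlowFrameU L₁ M₁ β U μ n).degree ≤ L₁ / 2 :=
    (frameOKDeg_klFlowFrameU hK₁ (hn.trans hN)).degree_le_half rfl hβmin (hL.trans hLL₁)
  have hsep := twoLeg_sep_fderiv_of_dual_offDiag_moment (L := L₁) (M := M₁) hβ0 U μ (klFlowFrameU L₁ M₁ β U μ n) n
    (hMs n hn Mq L₁ M₁ M₂ hLL₁ hM₁ hMq hM₁₂ hh₁ hh₂ hrates hframe) q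
  refine (norm_fderiv_evalM_symInterp_le_of_sep_at (L := L₁) (M := M₁) hdeg₁ β U μ n q hsep).trans ?_
  linarith [norm_iteratedFDeriv_one_frameShift_le_of_frameOK hR hK₁ q]

/-- **ROW C1 (`hcut`) AT EVERY SCALE ON THE MAXIMAL GEOMETRIC RATES `d·4^n` FROM DUAL-LATTICE DATA — budget bookkeeping discharged**: with
`0 ≤ d ≤ Q.CL β 0/4`, `Q.CL β 0·4^n ≤ Q.CL β n`, per scale `2·Ms n + 4/3·Gfr₁U² ≤ klCurveD` and two-cutoff dual data with `Dc n ≤ d·4^n/3` (rates `d·4^m`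
inside the binders, `F_n = d(4^n − 1)/3`), the literal `hcut` of the (e)/(M) closers holds at every `n ≤ N ≤ nScales β + 1` (the packaging matched to a
linear defect recursion of amplification `≤ 4`, COUNT (iv); twin of `spLeg_allScales_of_dualMoments_V17F2_geometric4`). -/
theorem cutLeg_allScales_of_dualMoments_V17F2_geometric4 (hR : ∀ j, 0 ≤ R.Gfr j) (hc : 0 < c) (hcle : c ≤ klCurveC3 R) (hU : 0 < U)
    (hUle : U ≤ klCurveU0 R) (hβmin : klBetaMin ≤ β) (hβc : β ≤ Real.exp (c / U ^ 2)) (hμ : μ ∈ klWindowC) (hL : klEngL₃ β U ≤ L)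
    (h0 : FrameOK R U (nScales β) μ 0) {N : ℕ} (hN : N ≤ nScales β + 1) {d : ℝ} (hd : 0 ≤ d) (hdCL : d ≤ Q.CL β 0 / 4)
    (hCL : ∀ n ≤ N, Q.CL β 0 * (4 : ℝ) ^ n ≤ Q.CL β n) {Ms Dc : ℕ → ℝ} (hMs0 : ∀ n ≤ N, 0 ≤ Ms n)
    (hsmall : ∀ n ≤ N, 2 * Ms n + 4 / 3 * R.Gfr 1 * U ^ 2 ≤ klCurveD) (hDc : ∀ n ≤ N, Dc n ≤ d * (4 : ℝ) ^ n / 3)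
    (hMs : ∀ n ≤ N, ∀ (Mq : ℕ → ℕ) (L₁ M₁ M₂ : ℕ) [NeZero L₁] [NeZero M₁] [NeZero M₂], L ≤ L₁ → Q.M0 β L₁ ≤ M₁ → Mq L₁ ≤ M₁ →
      M₁ ≤ M₂ →
      (∀ j < n, histV17F2 L₁ M₁ G P Q R β U μ j ∧ TwoLegSlopes L₁ M₁ R β U μ (klFlowFrameU L₁ M₁ β U μ j) j) →
      (∀ j < n, histV17F2 L₁ M₂ G P Q R β U μ j ∧ TwoLegSlopes L₁ M₂ R β U μ (klFlowFrameU L₁ M₂ β U μ j) j) →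
      (∀ m < n, ∀ θ : ℝ, |klLocalPart L₁ M₁ β U μ (klFlowFrameU L₁ M₁ β U μ m) m θ -
        klLocalPart L₁ M₂ β U μ (klFlowFrameU L₁ M₂ β U μ m) m θ| ≤ d * (4 : ℝ) ^ m / L₁) →
      (∀ q : Fin 2 → ℝ, |(klFlowFrameU L₁ M₁ β U μ n).eval q - (klFlowFrameU L₁ M₂ β U μ n).eval q| ≤
        (∑ m ∈ range n, d * (4 : ℝ) ^ m) / L₁) →
        ∀ (σ : Fin 2) (x₀ : SpaceTimeIdx L₁ M₁), imagTimeWeight β M₁ *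
          ∑ x ∈ (univ : Finset (Fin 2 → SpaceTimeIdx L₁ M₁)).filter (fun x => x 0 = x₀ ∧ (x 1).2 ≠ (x 0).2),
            (1 + ((((x 1).2 - (x 0).2) 0).valMinAbs.natAbs : ℝ) + ((((x 1).2 - (x 0).2) 1).valMinAbs.natAbs : ℝ)) ^ 1 *
              ‖sectorisedKernel L₁ M₁ β (trivialMultiplier L₁ M₁)
                  (klEffectiveAction L₁ M₁ β U μ (klFlowFrameU L₁ M₁ β U μ n) klE0 n - counterQuadratic L₁ M₁ β (klFlowFrameU L₁ M₁ β U μ n)) 2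
                  (![((0, σ), 0), ((0, σ), 1)] : Fin 2 → SectorLeg 1) x‖ ≤ Ms n)
    (hdual : ∀ n ≤ N, ∀ (Mq : ℕ → ℕ) (L₁ M₁ M₂ : ℕ) [NeZero L₁] [NeZero M₁] [NeZero M₂], L ≤ L₁ → Q.M0 β L₁ ≤ M₁ → Mq L₁ ≤ M₁ →
      M₁ ≤ M₂ →
      (∀ j < n, histV17F2 L₁ M₁ G P Q R β U μ j ∧ TwoLegSlopes L₁ M₁ R β U μ (klFlowFrameU L₁ M₁ β U μ j) j) →
      (∀ j < n, histV17F2 L₁ M₂ G P Q R β U μ j ∧ TwoLegSlopes L₁ M₂ R β U μ (klFlowFrameU L₁ M₂ β U μ j) j) →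
      (∀ m < n, ∀ θ : ℝ, |klLocalPart L₁ M₁ β U μ (klFlowFrameU L₁ M₁ β U μ m) m θ -
        klLocalPart L₁ M₂ β U μ (klFlowFrameU L₁ M₂ β U μ m) m θ| ≤ d * (4 : ℝ) ^ m / L₁) →
      (∀ q : Fin 2 → ℝ, |(klFlowFrameU L₁ M₁ β U μ n).eval q - (klFlowFrameU L₁ M₂ β U μ n).eval q| ≤
        (∑ m ∈ range n, d * (4 : ℝ) ^ m) / L₁) →
      ∃ (o₁ : SpaceTimeIdx L₁ M₁) (o₂ : SpaceTimeIdx L₁ M₂),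
        (∀ σ : Fin 2, ∑ y : TorusSite 2 L₁,
          (‖(imagTimeWeight β M₁ : ℂ) * (∑ t₁ : ImagTimeIdx M₁,
              sectorisedKernel L₁ M₁ β (trivialMultiplier L₁ M₁)
                  (klEffectiveAction L₁ M₁ β U μ (klFlowFrameU L₁ M₁ β U μ n) klE0 n - counterQuadratic L₁ M₁ β (klFlowFrameU L₁ M₁ β U μ n)) 2
                  (![((0, σ), 0), ((0, σ), 1)] : Fin 2 → SectorLeg 1) ![o₁, (t₁, o₁.2 + y)] *
                Complex.exp (((matsubaraFreq β M₁ (omega0 M₁) * (imagTime β M₁ o₁.1 - imagTime β M₁ t₁) : ℝ) : ℂ) * I)) -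
            (imagTimeWeight β M₂ : ℂ) * (∑ t₁ : ImagTimeIdx M₂,
              sectorisedKernel L₁ M₂ β (trivialMultiplier L₁ M₂)
                  (klEffectiveAction L₁ M₂ β U μ (klFlowFrameU L₁ M₂ β U μ n) klE0 n - counterQuadratic L₁ M₂ β (klFlowFrameU L₁ M₂ β U μ n)) 2
                  (![((0, σ), 0), ((0, σ), 1)] : Fin 2 → SectorLeg 1) ![o₂, (t₁, o₂.2 + y)] *
                Complex.exp (((matsubaraFreq β M₂ (omega0 M₂) * (imagTime β M₂ o₂.1 - imagTime β M₂ t₁) : ℝ) : ℂ) * I))‖ +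
          ‖(imagTimeWeight β M₁ : ℂ) * (∑ t₁ : ImagTimeIdx M₁,
              sectorisedKernel L₁ M₁ β (trivialMultiplier L₁ M₁)
                  (klEffectiveAction L₁ M₁ β U μ (klFlowFrameU L₁ M₁ β U μ n) klE0 n - counterQuadratic L₁ M₁ β (klFlowFrameU L₁ M₁ β U μ n)) 2
                  (![((0, σ), 0), ((0, σ), 1)] : Fin 2 → SectorLeg 1) ![o₁, (t₁, o₁.2 + -y)] *
                Complex.exp (((matsubaraFreq β M₁ (omega0 M₁) * (imagTime β M₁ o₁.1 - imagTime β M₁ t₁) : ℝ) : ℂ) * I)) -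
            (imagTimeWeight β M₂ : ℂ) * (∑ t₁ : ImagTimeIdx M₂,
              sectorisedKernel L₁ M₂ β (trivialMultiplier L₁ M₂)
                  (klEffectiveAction L₁ M₂ β U μ (klFlowFrameU L₁ M₂ β U μ n) klE0 n - counterQuadratic L₁ M₂ β (klFlowFrameU L₁ M₂ β U μ n)) 2
                  (![((0, σ), 0), ((0, σ), 1)] : Fin 2 → SectorLeg 1) ![o₂, (t₁, o₂.2 + -y)] *
                Complex.exp (((matsubaraFreq β M₂ (omega0 M₂) * (imagTime β M₂ o₂.1 - imagTime β M₂ t₁) : ℝ) : ℂ) * I))‖) ≤ Dc n / L₁) ∧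
        (∀ σ : Fin 2, ∑ y : TorusSite 2 L₁,
          (‖(imagTimeWeight β M₁ : ℂ) * (∑ t₁ : ImagTimeIdx M₁,
              sectorisedKernel L₁ M₁ β (trivialMultiplier L₁ M₁)
                  (klEffectiveAction L₁ M₁ β U μ (klFlowFrameU L₁ M₁ β U μ n) klE0 n - counterQuadratic L₁ M₁ β (klFlowFrameU L₁ M₁ β U μ n)) 2
                  (![((0, σ), 0), ((0, σ), 1)] : Fin 2 → SectorLeg 1) ![o₁, (t₁, o₁.2 + y)] *
                Complex.exp (((matsubaraFreq β M₁ (omega0 M₁).rev * (imagTime β M₁ o₁.1 - imagTime β M₁ t₁) : ℝ) : ℂ) * I)) -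
            (imagTimeWeight β M₂ : ℂ) * (∑ t₁ : ImagTimeIdx M₂,
              sectorisedKernel L₁ M₂ β (trivialMultiplier L₁ M₂)
                  (klEffectiveAction L₁ M₂ β U μ (klFlowFrameU L₁ M₂ β U μ n) klE0 n - counterQuadratic L₁ M₂ β (klFlowFrameU L₁ M₂ β U μ n)) 2
                  (![((0, σ), 0), ((0, σ), 1)] : Fin 2 → SectorLeg 1) ![o₂, (t₁, o₂.2 + y)] *
                Complex.exp (((matsubaraFreq β M₂ (omega0 M₂).rev * (imagTime β M₂ o₂.1 - imagTime β M₂ t₁) : ℝ) : ℂ) * I))‖ +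
          ‖(imagTimeWeight β M₁ : ℂ) * (∑ t₁ : ImagTimeIdx M₁,
              sectorisedKernel L₁ M₁ β (trivialMultiplier L₁ M₁)
                  (klEffectiveAction L₁ M₁ β U μ (klFlowFrameU L₁ M₁ β U μ n) klE0 n - counterQuadratic L₁ M₁ β (klFlowFrameU L₁ M₁ β U μ n)) 2
                  (![((0, σ), 0), ((0, σ), 1)] : Fin 2 → SectorLeg 1) ![o₁, (t₁, o₁.2 + -y)] *
                Complex.exp (((matsubaraFreq β M₁ (omega0 M₁).rev * (imagTime β M₁ o₁.1 - imagTime β M₁ t₁) : ℝ) : ℂ) * I)) -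
            (imagTimeWeight β M₂ : ℂ) * (∑ t₁ : ImagTimeIdx M₂,
              sectorisedKernel L₁ M₂ β (trivialMultiplier L₁ M₂)
                  (klEffectiveAction L₁ M₂ β U μ (klFlowFrameU L₁ M₂ β U μ n) klE0 n - counterQuadratic L₁ M₂ β (klFlowFrameU L₁ M₂ β U μ n)) 2
                  (![((0, σ), 0), ((0, σ), 1)] : Fin 2 → SectorLeg 1) ![o₂, (t₁, o₂.2 + -y)] *
                Complex.exp (((matsubaraFreq β M₂ (omega0 M₂).rev * (imagTime β M₂ o₂.1 - imagTime β M₂ t₁) : ℝ) : ℂ) * I))‖) ≤ Dc n / L₁)) :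
    ∀ n ≤ N, ∀ (Mq : ℕ → ℕ) (L₁ M₁ M₂ : ℕ) [NeZero L₁] [NeZero M₁] [NeZero M₂], L ≤ L₁ → Q.M0 β L₁ ≤ M₁ → Mq L₁ ≤ M₁ → M₁ ≤ M₂ →
      (∀ j < n, histV17F2 L₁ M₁ G P Q R β U μ j ∧ TwoLegSlopes L₁ M₁ R β U μ (klFlowFrameU L₁ M₁ β U μ j) j) →
      (∀ j < n, histV17F2 L₁ M₂ G P Q R β U μ j ∧ TwoLegSlopes L₁ M₂ R β U μ (klFlowFrameU L₁ M₂ β U μ j) j) →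
        ∀ θ : ℝ, |klLocalPart L₁ M₁ β U μ (klFlowFrameU L₁ M₁ β U μ n) n θ -
          klLocalPart L₁ M₂ β U μ (klFlowFrameU L₁ M₂ β U μ n) n θ| ≤ Q.CL β n / 4 / L₁ := by
  have hDpos : 0 < klCurveD := by unfold klCurveD; linarith [cDtmin_window_ge]
  refine cutLeg_allScales_of_dualMoments_V17F2_rates (G := G) (P := P) (a := fun m => d * (4 : ℝ) ^ m) (Ms := Ms) (Dc := Dc)
    hR hc hcle hU hUle hβmin hβc hμ hL h0 hN (fun n hn => ?_) hMs0 hMs hdual (fun n hn => ?_)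
  · calc d * (4 : ℝ) ^ n ≤ Q.CL β 0 / 4 * (4 : ℝ) ^ n := mul_le_mul_of_nonneg_right hdCL (by positivity)
      _ = Q.CL β 0 * (4 : ℝ) ^ n / 4 := by ring
      _ ≤ Q.CL β n / 4 := div_le_div_of_nonneg_right (hCL n hn) (by norm_num)
  · rw [sum_range_mul_four_pow]
    have hF0 : 0 ≤ d * ((4 : ℝ) ^ n - 1) / 3 := by
      have : (1 : ℝ) ≤ (4 : ℝ) ^ n := one_le_pow₀ (by norm_num)
      have : 0 ≤ d * ((4 : ℝ) ^ n - 1) := mul_nonneg hd (by linarith)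
      linarith
    have h1 : (2 * Ms n + 4 / 3 * R.Gfr 1 * U ^ 2) * (d * ((4 : ℝ) ^ n - 1) / 3) / klCurveD ≤ d * ((4 : ℝ) ^ n - 1) / 3 := by
      rw [div_le_iff₀ hDpos]
      calc (2 * Ms n + 4 / 3 * R.Gfr 1 * U ^ 2) * (d * ((4 : ℝ) ^ n - 1) / 3)
          ≤ klCurveD * (d * ((4 : ℝ) ^ n - 1) / 3) := mul_le_mul_of_nonneg_right (hsmall n hn) hF0
        _ = d * ((4 : ℝ) ^ n - 1) / 3 * klCurveD := by ring
    have h2 := hDc n hn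
    have h3 : d * ((4 : ℝ) ^ n - 1) / 3 + (d * ((4 : ℝ) ^ n - 1) / 3 + Dc n) ≤ d * (4 : ℝ) ^ n := by nlinarith
    linarith

end V17F2

end Summit.HubbardSuperconductivity.HubbardSuperconductivity.Theorems.EngineV8

end
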